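import Mathlib
import HarnessLib
import Literature.Analysis.FluidPDE.VorticityCalculus
import Literature.Analysis.FluidPDE.HarmonicRemovableSingularity
import Literature.Analysis.FluidPDE.LocalBiotSavartHelmholtz
import Literature.Analysis.PDE.HarmonicSmoothLiouville
import Summits.NavierStokesRegularity.NavierStokesRegularity.Theorems.UnthreadedDoorAntidynamoSingleDegreeKinematics
import Summits.NavierStokesRegularity.NavierStokesRegularity.Theorems.UnthreadedDoorAntidynamoSolidHarmonicProfile
import Summits.NavierStokesRegularity.NavierStokesRegularity.Theorems.UnthreadedDoorAntidynamoSphereConstancy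
import Summits.NavierStokesRegularity.NavierStokesRegularity.Theorems.UnthreadedDoorAntidynamoLocalLaplacianProduct

/-!
# Route `UnthreadedDoor` / `ThreadingFlux`, crux `PoloidalLiouville` (stmt-NavierStokesRegularity-1222), antidynamo v2 skeleton,
# rung `stub_singleDegreeRung`, EVEN degree — (E1b) THE KINEMATIC REMAINDER: `w = u(x₀ + ·) − (aP)•y − k•∇P` is SMOOTH ON ℝ³,
# CURL-FREE, DIVERGENCE-FREE and of growth `O(r log r)`

Support file (census instrument decomp-ns-census-1 g34, cell decomp-ns; `--supports stmt-NavierStokesRegularity-1222 --as helper`; 0 kit).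

Input of the (E1) assembly of the even rung.  Data at a slice: `u` smooth, bounded, divergence-free on `ℝ³` with
`curl u(x) = ĝ(‖x − x₀‖)•(∇P(x − x₀) × (x − x₀))` off `x₀` (`P` the profile: `C^∞`, harmonic, positively homogeneous of degree `l ≥ 2` with
Euler's identity), and radial profiles `a, k ∈ C^∞(0,∞)` with `ĝ = a − k′/r`, `r a′ + (l+3)a + l k′/r = 0`, `|a|·r^l ≤ C`,
`|k|·r^{l−1} ≤ C·r(1 + |log r|)` (p813766, (E1a)).  The explicit field `V(y) = (a(‖y‖)P(y))•y + k(‖y‖)•∇P(y)` is smooth off the origin with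
`curl V = ĝ•(∇P × y)` and `div V = 0` there (p800499), and `‖V(y)‖ ≲ ‖y‖(1 + |log ‖y‖|)`.  THIS FILE proves that the remainder
`w(y) = u(x₀ + y) − V(y)` is

* harmonic off the origin (`laplacian_eq_zero_of_curl_div_eq_zero_of_isOpen` — a LOCAL «curl-free + divergence-free ⟹ harmonic», by a bump
  cut-off and the tree's localisation formula `laplacian_smul_add_curl_smul_curl_eq`),
* continuous at the origin (`V → 0`: sphere bounds for `P`, `∇P` + the profile bounds), hence — removable singularities in `ℝ³`
  (`harmonicAt_of_harmonic_punctured_of_continuousAt`) and smoothness of entire harmonic functions (`contDiff_of_harmonicOnNhd_univ`) —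
  SMOOTH ON ALL OF `ℝ³`, with `curl w ≡ 0`, `div w ≡ 0` (by continuity at the origin),
* of growth `‖w(y)‖ ≤ A + B‖y‖(1 + |log ‖y‖|)`.

★★ `kinematicRemainder` — THE EXPORT, exactly the input of `affine_symm_traceFree_of_curl_div_log_growth` (HarmonicLogGrowth, (E1b′)) and
then of `strainKill` (p813842, (E1c)).

HONEST LABEL: vector calculus and classical potential theory (all inputs are tree theorems) serving the open EVEN-degree rung of an S-free
Liouville engine; the rung, the wall `stub_scalarLiouville`, `PoloidalLiouville` (1222) and Navier–Stokes regularity are NOT touched (crux 1222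
is INCOMPARABLE with the summit; descent inside the door's cone, decorative for the summit).  Nothing here proves NavierStokesRegularity.
[folklore]
-/

noncomputable section

-- the summit and its single sub-problem share the name (CONVENTIONS §1), as in every Theorems file
set_option linter.dupNamespace false

open scoped Topology InnerProductSpace RealInnerProductSpace ContDiff Laplacian
open Filter Set Metric InnerProductSpace
open Literature.Analysis.FluidPDE

namespace Summit.NavierStokesRegularity.NavierStokesRegularity.Theorems.PoloidalLiouville.Antidynamo

/-! ### A local «curl-free + divergence-free ⟹ harmonic» -/

/-- **LOCAL HARMONICITY.**  A field of class `C²` on an open set `U ⊆ ℝ³` with `curl w = 0` and `div w = 0` on `U` is harmonic on `U`: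
`Δw(y) = 0` for `y ∈ U`.  [Cut off with a bump `b ≡ 1` near `y` supported in `U`; the tree's localisation formula
`laplacian_smul_add_curl_smul_curl_eq` for `(b•w, b)` has vanishing right-hand side (`Db(y) = 0`, `Δb(y) = 0`) and vanishing curl term
(`curl (b•w) = curl w = 0` near `y`).] [folklore] -/
theorem laplacian_eq_zero_of_curl_div_eq_zero_of_isOpen {U : Set (EuclideanSpace ℝ (Fin 3))} (hU : IsOpen U)
    {w : EuclideanSpace ℝ (Fin 3) → EuclideanSpace ℝ (Fin 3)} (hw : ContDiffOn ℝ 2 w U)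
    (hcurl : ∀ z ∈ U, curl w z = 0) (hdiv : ∀ z ∈ U, VectorCalculus.divergence w z = 0)
    {y : EuclideanSpace ℝ (Fin 3)} (hy : y ∈ U) : (Δ w) y = 0 := by
  obtain ⟨r, hr, hball⟩ := Metric.isOpen_iff.1 hU y hy
  let b : ContDiffBump y := ⟨r / 4, r / 2, by positivity, by linarith⟩
  have hsupp : tsupport (b : EuclideanSpace ℝ (Fin 3) → ℝ) ⊆ U := by
    rw [b.tsupport_eq]
    exact (closedBall_subset_ball (by show r / 2 < r; linarith)).trans hball
  set V : EuclideanSpace ℝ (Fin 3) → EuclideanSpace ℝ (Fin 3) := fun z => (b z) • w z with hV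
  have hV2 : ContDiff ℝ 2 V := contDiff_bump_smul_of_contDiffOn (n := 2) hU hw b hsupp
  have hb2 : ContDiff ℝ 2 (b : EuclideanSpace ℝ (Fin 3) → ℝ) := b.contDiff
  -- on the small ball `B(y, r/4)` the bump is `1`, so `V = w` there
  have hball4 : ball y (r / 4) ⊆ U := (ball_subset_ball (by linarith)).trans hball
  have hVw : ∀ z ∈ ball y (r / 4), V =ᶠ[𝓝 z] w := by
    intro z hz
    filter_upwards [isOpen_ball.mem_nhds hz] with z' hz'
    have h1 : b z' = 1 := b.one_of_mem_closedBall (ball_subset_closedBall hz')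
    simp only [hV, h1, one_smul]
  have hy4 : y ∈ ball y (r / 4) := mem_ball_self (by positivity)
  -- `curl V = 0` and `div V = 0` near `y`
  have hcurlV : ∀ z ∈ ball y (r / 4), curl V z = 0 := fun z hz => by
    rw [curl_eq_curlCLM, (hVw z hz).fderiv_eq, ← curl_eq_curlCLM, hcurl z (hball4 hz)]
  have hdivV : ∀ᶠ z in 𝓝 y, VectorCalculus.divergence V z = 0 := by
    filter_upwards [isOpen_ball.mem_nhds hy4] with z hz
    rw [VectorCalculus.divergence, (hVw z hz).fderiv_eq, ← VectorCalculus.divergence, hdiv z (hball4 hz)]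
  -- the bump is locally constant at `y`
  have hb1 : (b : EuclideanSpace ℝ (Fin 3) → ℝ) =ᶠ[𝓝 y] fun _ => (1 : ℝ) := b.eventuallyEq_one
  have hDb : fderiv ℝ (b : EuclideanSpace ℝ (Fin 3) → ℝ) y = 0 := by
    rw [hb1.fderiv_eq, fderiv_const_apply]
  have hΔb : (Δ (b : EuclideanSpace ℝ (Fin 3) → ℝ)) y = 0 := by
    rw [(laplacian_congr_nhds hb1).eq_of_nhds]
    simp
  -- the localisation formula
  have key := laplacian_smul_add_curl_smul_curl_eq hV2 hb2 (Or.inr hdivV)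
  have hsr : (0 : EuclideanSpace ℝ (Fin 3) →L[ℝ] ℝ).smulRight (curl V y) = 0 := by ext v; simp
  have hsum : ∑ i, ((0 : EuclideanSpace ℝ (Fin 3) →L[ℝ] ℝ) (stdOrthonormalBasis ℝ (EuclideanSpace ℝ (Fin 3)) i)) •
      fderiv ℝ V y (stdOrthonormalBasis ℝ (EuclideanSpace ℝ (Fin 3)) i) = 0 :=
    Finset.sum_eq_zero fun i _ => by rw [show (0 : EuclideanSpace ℝ (Fin 3) →L[ℝ] ℝ) _ = 0 from rfl, zero_smul]
  rw [hDb, hΔb, hsr, map_zero, hsum, smul_zero, zero_smul, add_zero, add_zero] at key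
  -- the curl term vanishes: `b • curl V = 0` near `y`
  have hzero : (fun z => b z • curl V z) =ᶠ[𝓝 y] fun _ => (0 : EuclideanSpace ℝ (Fin 3)) := by
    filter_upwards [isOpen_ball.mem_nhds hy4] with z hz
    rw [hcurlV z hz, smul_zero]
  have hcurl0 : curl (fun z => b z • curl V z) y = 0 := by
    rw [curl_eq_curlCLM, hzero.fderiv_eq, fderiv_const_apply, map_zero]
  rw [hcurl0, add_zero] at key
  -- and `b • V = w` near `y`
  have hbV : (fun z => b z • V z) =ᶠ[𝓝 y] w := by
    filter_upwards [hb1, hVw y hy4] with z h1 h2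
    rw [h1, one_smul, h2]
  rw [← (laplacian_congr_nhds hbV).eq_of_nhds]
  exact key

/-! ### Sphere bounds for the profile -/

/-- A continuous positively homogeneous function of degree `l` is `O(‖y‖^l)`: `|P y| ≤ C ‖y‖^l` (`l ≥ 1`). [folklore] -/
theorem exists_abs_le_mul_pow_of_homogeneous {P : EuclideanSpace ℝ (Fin 3) → ℝ} (hP : Continuous P) {l : ℕ} (hl : 1 ≤ l)
    (hhom : ∀ r : ℝ, 0 < r → ∀ y : EuclideanSpace ℝ (Fin 3), P (r • y) = r ^ l * P y) :
    ∃ C, 0 ≤ C ∧ ∀ y, |P y| ≤ C * ‖y‖ ^ l := by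
  obtain ⟨C, hC⟩ := (isCompact_sphere (0 : EuclideanSpace ℝ (Fin 3)) 1).exists_bound_of_continuousOn hP.continuousOn
  refine ⟨max C 0, le_max_right _ _, fun y => ?_⟩
  by_cases hy : y = 0
  · rw [hy, eq_zero_at_zero_of_homogeneous hl hhom, abs_zero, norm_zero, zero_pow (by omega), mul_zero]
  · have hr : 0 < ‖y‖ := norm_pos_iff.mpr hy
    have hu : ‖y‖⁻¹ • y ∈ sphere (0 : EuclideanSpace ℝ (Fin 3)) 1 := by
      rw [mem_sphere_zero_iff_norm, norm_smul, norm_inv, norm_norm, inv_mul_cancel₀ hr.ne']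
    have h := hC _ hu
    have hy' : y = ‖y‖ • (‖y‖⁻¹ • y) := by rw [smul_smul, mul_inv_cancel₀ hr.ne', one_smul]
    rw [Real.norm_eq_abs] at h
    calc |P y| = |P (‖y‖ • (‖y‖⁻¹ • y))| := by rw [← hy']
      _ = ‖y‖ ^ l * |P (‖y‖⁻¹ • y)| := by rw [hhom _ hr, abs_mul, abs_of_pos (pow_pos hr _)]
      _ ≤ ‖y‖ ^ l * max C 0 := mul_le_mul_of_nonneg_left (h.trans (le_max_left _ _)) (pow_pos hr _).le
      _ = max C 0 * ‖y‖ ^ l := mul_comm _ _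

/-- The gradient of a `C¹` positively homogeneous function of degree `l ≥ 2` vanishes at the origin and is `O(‖y‖^{l−1})`. [folklore] -/
theorem exists_norm_gradient_le_mul_pow_of_homogeneous {P : EuclideanSpace ℝ (Fin 3) → ℝ} (hP : ContDiff ℝ 1 P) {l : ℕ}
    (hl : 2 ≤ l) (hhom : ∀ r : ℝ, 0 < r → ∀ y : EuclideanSpace ℝ (Fin 3), P (r • y) = r ^ l * P y) :
    gradient P 0 = 0 ∧ ∃ C, 0 ≤ C ∧ ∀ y, ‖gradient P y‖ ≤ C * ‖y‖ ^ (l - 1) := by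
  have hPd : Differentiable ℝ P := hP.differentiable one_ne_zero
  have hgc : Continuous (gradient P) := by
    have : gradient P = fun y => (InnerProductSpace.toDual ℝ (EuclideanSpace ℝ (Fin 3))).symm (fderiv ℝ P y) := rfl
    rw [this]
    exact (InnerProductSpace.toDual ℝ _).symm.continuous.comp (hP.continuous_fderiv one_ne_zero)
  -- at the origin
  have h0 : gradient P 0 = 0 := by
    have h := gradient_smul_of_homogeneous hPd hhom (r := 2) two_pos 0
    rw [smul_zero] at h
    have h2 : ((2 : ℝ) ^ l * 2⁻¹ - 1) • gradient P 0 = 0 := by rw [sub_smul, one_smul, ← h, sub_self]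
    rcases smul_eq_zero.mp h2 with h3 | h3
    · exfalso
      have h4 : (4 : ℝ) ≤ 2 ^ l := by
        calc (4 : ℝ) = 2 ^ 2 := by norm_num
          _ ≤ 2 ^ l := pow_le_pow_right₀ (by norm_num) hl
      linarith
    · exact h3
  refine ⟨h0, ?_⟩
  obtain ⟨C, hC⟩ := (isCompact_sphere (0 : EuclideanSpace ℝ (Fin 3)) 1).exists_bound_of_continuousOn hgc.continuousOn
  refine ⟨max C 0, le_max_right _ _, fun y => ?_⟩
  by_cases hy : y = 0
  · rw [hy, h0, norm_zero]
    positivity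
  · have hr : 0 < ‖y‖ := norm_pos_iff.mpr hy
    have hu : ‖y‖⁻¹ • y ∈ sphere (0 : EuclideanSpace ℝ (Fin 3)) 1 := by
      rw [mem_sphere_zero_iff_norm, norm_smul, norm_inv, norm_norm, inv_mul_cancel₀ hr.ne']
    have h := hC _ hu
    have hy' : y = ‖y‖ • (‖y‖⁻¹ • y) := by rw [smul_smul, mul_inv_cancel₀ hr.ne', one_smul]
    have hpow : ‖y‖ ^ l * ‖y‖⁻¹ = ‖y‖ ^ (l - 1) := by
      obtain ⟨m, rfl⟩ : ∃ m, l = m + 1 := ⟨l - 1, by omega⟩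
      rw [pow_succ, Nat.add_sub_cancel, mul_assoc, mul_inv_cancel₀ hr.ne', mul_one]
    calc ‖gradient P y‖ = ‖gradient P (‖y‖ • (‖y‖⁻¹ • y))‖ := by rw [← hy']
      _ = ‖y‖ ^ (l - 1) * ‖gradient P (‖y‖⁻¹ • y)‖ := by
          rw [gradient_smul_of_homogeneous hPd hhom hr, norm_smul, Real.norm_eq_abs, hpow, abs_of_pos (pow_pos hr _)]
      _ ≤ ‖y‖ ^ (l - 1) * max C 0 := mul_le_mul_of_nonneg_left (h.trans (le_max_left _ _)) (pow_pos hr _).le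
      _ = max C 0 * ‖y‖ ^ (l - 1) := mul_comm _ _

/-! ### ★★ The kinematic remainder -/

/-- ★★ **THE KINEMATIC REMAINDER OF AN EVEN SLICE.**  Let `u` be smooth, bounded and divergence-free on `ℝ³` with
`curl u(x) = ĝ(‖x − x₀‖)•(∇P(x − x₀) × (x − x₀))` off `x₀`, where `P` is smooth, harmonic, positively homogeneous of degree `l ≥ 2` with Euler's
identity, and let `a, k ∈ C^∞(0,∞)` be radial profiles with `ĝ = a − k′/r`, `r a′ + (l+3)a + l k′/r = 0`, `|a|·r^l ≤ C`,
`|k|·r^{l−1} ≤ C·r(1 + |log r|)` (p813766).  Then the remainder `w(y) = u(x₀ + y) − (a(‖y‖)P(y))•y − k(‖y‖)•∇P(y)` is SMOOTH ON `ℝ³`,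
CURL-FREE, DIVERGENCE-FREE, and `‖w(y)‖ ≤ A + B‖y‖(1 + |log ‖y‖|)`. [folklore] -/
theorem kinematicRemainder
    {u : EuclideanSpace ℝ (Fin 3) → EuclideanSpace ℝ (Fin 3)} (hu : ContDiff ℝ ∞ u) {M : ℝ} (hM : ∀ x, ‖u x‖ ≤ M)
    (hdivu : VectorCalculus.IsDivFree u) (x₀ : EuclideanSpace ℝ (Fin 3))
    {P : EuclideanSpace ℝ (Fin 3) → ℝ} (hP : ContDiff ℝ ∞ P) {l : ℕ} (hl : 2 ≤ l)
    (hhom : ∀ r : ℝ, 0 < r → ∀ y : EuclideanSpace ℝ (Fin 3), P (r • y) = r ^ l * P y)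
    (hEuler : ∀ z : EuclideanSpace ℝ (Fin 3), ⟪gradient P z, z⟫ = (l : ℝ) * P z) (hharm : ∀ z, (Δ P) z = 0)
    {ĝ a k : ℝ → ℝ} (ha : ContDiffOn ℝ ∞ a (Ioi 0)) (hk : ContDiffOn ℝ ∞ k (Ioi 0))
    (hG : ∀ r, 0 < r → ĝ r = a r - deriv k r / r)
    (hdiv : ∀ r, 0 < r → r * deriv a r + ((l : ℝ) + 3) * a r + (l : ℝ) * deriv k r / r = 0)
    {C : ℝ} (haC : ∀ r, 0 < r → |a r| * r ^ l ≤ C) (hkC : ∀ r, 0 < r → |k r| * r ^ (l - 1) ≤ C * r * (1 + |Real.log r|))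
    (hcurl : ∀ x, x ≠ x₀ → curl u x = ĝ ‖x - x₀‖ • cross (gradient P (x - x₀)) (x - x₀))
    {w : EuclideanSpace ℝ (Fin 3) → EuclideanSpace ℝ (Fin 3)}
    (hw : ∀ y, w y = u (x₀ + y) - ((a ‖y‖ * P y) • y + k ‖y‖ • gradient P y)) :
    ContDiff ℝ ∞ w ∧ (∀ y, curl w y = 0) ∧ VectorCalculus.IsDivFree w ∧
      ∃ A B : ℝ, ∀ y, ‖w y‖ ≤ A + B * ‖y‖ * (1 + |Real.log ‖y‖|) := by
  -- ### the three fields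
  set V : EuclideanSpace ℝ (Fin 3) → EuclideanSpace ℝ (Fin 3) := fun y => (a ‖y‖ * P y) • y + k ‖y‖ • gradient P y with hV
  set τ : EuclideanSpace ℝ (Fin 3) → EuclideanSpace ℝ (Fin 3) := fun y => u (x₀ + y) with hτ
  have hwf : w = fun y => τ y - V y := funext fun y => by rw [hw y]
  have hτs : ContDiff ℝ ∞ τ := hu.comp (contDiff_const.add contDiff_id)
  have hP2 : ContDiff ℝ 2 P := hP.of_le (by norm_cast)
  have hgradP : ContDiff ℝ ∞ (gradient P) := by
    have : gradient P = fun y => (InnerProductSpace.toDual ℝ (EuclideanSpace ℝ (Fin 3))).symm (fderiv ℝ P y) := rfl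
    rw [this]
    exact (InnerProductSpace.toDual ℝ _).symm.contDiff.comp (hP.fderiv_right (m := ∞) (by simp))
  -- ### `V` is smooth off the origin
  set U : Set (EuclideanSpace ℝ (Fin 3)) := {0}ᶜ with hU
  have hUo : IsOpen U := isOpen_compl_singleton
  have hrad : ∀ {f : ℝ → ℝ}, ContDiffOn ℝ ∞ f (Ioi 0) → ContDiffOn ℝ ∞ (fun y : EuclideanSpace ℝ (Fin 3) => f ‖y‖) U := by
    intro f hf y hy
    have hy0 : y ≠ 0 := hy
    exact ((hf.contDiffAt (Ioi_mem_nhds (norm_pos_iff.2 hy0))).comp y (contDiffAt_norm ℝ hy0)).contDiffWithinAt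
  have hVs : ContDiffOn ℝ ∞ V U :=
    (((hrad ha).mul hP.contDiffOn).smul contDiffOn_id).add ((hrad hk).smul hgradP.contDiffOn)
  have hws : ContDiffOn ℝ ∞ w U := by rw [hwf]; exact hτs.contDiffOn.sub hVs
  -- ### curl and divergence of `w` off the origin
  have hdiffV : ∀ y, y ≠ 0 → DifferentiableAt ℝ V y := fun y hy =>
    (hVs.differentiableOn (by simp)).differentiableAt (hUo.mem_nhds hy)
  have hda : ∀ y : EuclideanSpace ℝ (Fin 3), y ≠ 0 → DifferentiableAt ℝ a ‖y‖ := fun y hy =>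
    (ha.differentiableOn (by simp)).differentiableAt (Ioi_mem_nhds (norm_pos_iff.2 hy))
  have hdk : ∀ y : EuclideanSpace ℝ (Fin 3), y ≠ 0 → DifferentiableAt ℝ k ‖y‖ := fun y hy =>
    (hk.differentiableOn (by simp)).differentiableAt (Ioi_mem_nhds (norm_pos_iff.2 hy))
  have hcurl_off : ∀ y, y ≠ 0 → curl w y = 0 := by
    intro y hy
    have hx : x₀ + y ≠ x₀ := fun h => hy (by simpa using h)
    have h1 : curl τ y = curl u (x₀ + y) := by simp only [hτ, curl, fderiv_comp_add_left]
    have h2 : curl V y = ĝ ‖y‖ • cross (gradient P y) y := by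
      rw [hV, curl_singleDegreeField hP2 hy (hda y hy) (hdk y hy), hG _ (norm_pos_iff.2 hy)]
    rw [hwf, curl_sub (hτs.differentiable (by simp) y) (hdiffV y hy), h1, h2, hcurl _ hx, add_sub_cancel_left, sub_self]
  have hdiv_off : ∀ y, y ≠ 0 → VectorCalculus.divergence w y = 0 := by
    intro y hy
    have h1 : VectorCalculus.divergence τ y = 0 := by
      have := hdivu (x₀ + y)
      rw [VectorCalculus.divergence] at this ⊢
      rwa [hτ, fderiv_comp_add_left]
    have h2 : VectorCalculus.divergence V y = 0 := by
      rw [hV, divergence_singleDegreeField hP2 hEuler hharm hy (hda y hy) (hdk y hy), hdiv _ (norm_pos_iff.2 hy), zero_mul]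
    rw [hwf, VectorCalculus.divergence, fderiv_fun_sub (hτs.differentiable (by simp) y) (hdiffV y hy),
      ContinuousLinearMap.toLinearMap_sub, map_sub]
    rw [VectorCalculus.divergence] at h1 h2
    rw [h1, h2, sub_zero]
  -- ### `w` is harmonic off the origin
  have hΔ_off : ∀ y, y ≠ 0 → (Δ w) y = 0 := fun y hy =>
    laplacian_eq_zero_of_curl_div_eq_zero_of_isOpen hUo (hws.of_le (by norm_cast)) (fun z hz => hcurl_off z hz)
      (fun z hz => hdiv_off z hz) hy
  -- ### `V → 0` at the origin, `w` continuous there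
  obtain ⟨CP, hCP0, hCP⟩ := exists_abs_le_mul_pow_of_homogeneous hP.continuous (by omega : 1 ≤ l) hhom
  obtain ⟨hg0, CG, hCG0, hCG⟩ := exists_norm_gradient_le_mul_pow_of_homogeneous (hP.of_le (by norm_cast)) hl hhom
  have hC0 : 0 ≤ C := le_trans (by positivity) (haC 1 one_pos)
  have hVbd : ∀ y, ‖V y‖ ≤ C * CP * ‖y‖ + C * CG * (‖y‖ * (1 + |Real.log ‖y‖|)) := by
    intro y
    by_cases hy : y = 0
    · rw [hy, hV]
      simp [hg0]
    have hr : 0 < ‖y‖ := norm_pos_iff.2 hy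
    have hpow : ‖y‖ ^ l = ‖y‖ ^ (l - 1) * ‖y‖ := by
      obtain ⟨m, rfl⟩ : ∃ m, l = m + 1 := ⟨l - 1, by omega⟩
      rw [pow_succ, Nat.add_sub_cancel]
    have h1 : ‖(a ‖y‖ * P y) • y‖ ≤ C * CP * ‖y‖ := by
      rw [norm_smul, Real.norm_eq_abs, abs_mul]
      calc |a ‖y‖| * |P y| * ‖y‖ ≤ |a ‖y‖| * (CP * ‖y‖ ^ l) * ‖y‖ := by gcongr; exact hCP y
        _ = CP * (|a ‖y‖| * ‖y‖ ^ l) * ‖y‖ := by ring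
        _ ≤ CP * C * ‖y‖ := by gcongr; exact haC _ hr
        _ = C * CP * ‖y‖ := by ring
    have h2 : ‖k ‖y‖ • gradient P y‖ ≤ C * CG * (‖y‖ * (1 + |Real.log ‖y‖|)) := by
      rw [norm_smul, Real.norm_eq_abs]
      calc |k ‖y‖| * ‖gradient P y‖ ≤ |k ‖y‖| * (CG * ‖y‖ ^ (l - 1)) := by gcongr; exact hCG y
        _ = CG * (|k ‖y‖| * ‖y‖ ^ (l - 1)) := by ring
        _ ≤ CG * (C * ‖y‖ * (1 + |Real.log ‖y‖|)) := mul_le_mul_of_nonneg_left (hkC _ hr) hCG0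
        _ = C * CG * (‖y‖ * (1 + |Real.log ‖y‖|)) := by ring
    calc ‖V y‖ ≤ ‖(a ‖y‖ * P y) • y‖ + ‖k ‖y‖ • gradient P y‖ := norm_add_le _ _
      _ ≤ _ := add_le_add h1 h2
  have hΦc : Continuous fun y : EuclideanSpace ℝ (Fin 3) =>
      C * CP * ‖y‖ + C * CG * (‖y‖ + |‖y‖ * Real.log ‖y‖|) :=
    ((continuous_const.mul continuous_norm).add
      (continuous_const.mul (continuous_norm.add ((Real.continuous_mul_log.comp continuous_norm).abs))))
  have hV0 : Tendsto V (𝓝 0) (𝓝 0) := by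
    have hbd : ∀ y, ‖V y‖ ≤ C * CP * ‖y‖ + C * CG * (‖y‖ + |‖y‖ * Real.log ‖y‖|) := by
      intro y
      have h := hVbd y
      have e : ‖y‖ * (1 + |Real.log ‖y‖|) = ‖y‖ + |‖y‖ * Real.log ‖y‖| := by
        rw [abs_mul, abs_of_nonneg (norm_nonneg y)]; ring
      rwa [e] at h
    refine squeeze_zero_norm hbd ?_
    have h := hΦc.tendsto 0
    simp only [norm_zero, Real.log_zero, mul_zero, abs_zero, add_zero] at h
    exact h
  have hw0 : ContinuousAt w 0 := by
    rw [hwf]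
    have hV0' : ContinuousAt V 0 := by
      have hV00 : V 0 = 0 := by rw [hV]; simp [hg0]
      rw [ContinuousAt, hV00]
      exact hV0
    exact hτs.continuous.continuousAt.sub hV0'
  -- ### removable singularity, coordinate by coordinate: `w` is smooth on `ℝ³`
  have hsmooth : ContDiff ℝ ∞ w := by
    rw [contDiff_euclidean]
    intro i
    set g : EuclideanSpace ℝ (Fin 3) → ℝ := fun y => w y i with hg
    have hgeq : g = (EuclideanSpace.proj i : EuclideanSpace ℝ (Fin 3) →L[ℝ] ℝ) ∘ w := by funext y; rfl
    have hHoff : ∀ y, y ≠ 0 → HarmonicAt g y := by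
      intro y hy
      have hwy : ContDiffAt ℝ ∞ w y := hws.contDiffAt (hUo.mem_nhds hy)
      refine ⟨?_, ?_⟩
      · rw [hgeq]
        exact (EuclideanSpace.proj i : EuclideanSpace ℝ (Fin 3) →L[ℝ] ℝ).contDiff.contDiffAt.comp y (hwy.of_le (by norm_cast))
      · filter_upwards [hUo.mem_nhds hy] with z hz
        have hz0 : z ≠ 0 := hz
        have hwz : ContDiffAt ℝ 2 w z := (hws.contDiffAt (hUo.mem_nhds hz0)).of_le (by norm_cast)
        rw [hgeq, hwz.laplacian_CLM_comp_left, Function.comp_apply, hΔ_off z hz0, map_zero, Pi.zero_apply]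
    have hg0c : ContinuousAt g 0 := by
      rw [hgeq]
      exact (EuclideanSpace.proj i : EuclideanSpace ℝ (Fin 3) →L[ℝ] ℝ).continuous.continuousAt.comp hw0
    have hH0 : HarmonicAt g 0 :=
      harmonicAt_of_harmonic_punctured_of_continuousAt (E := EuclideanSpace ℝ (Fin 3)) (by simp) one_pos
        (fun y _ hy => hHoff y hy) hg0c
    have hH : HarmonicOnNhd g univ := by
      intro y _
      by_cases hy : y = 0
      · rw [hy]; exact hH0
      · exact hHoff y hy
    exact Literature.Analysis.PDE.contDiff_of_harmonicOnNhd_univ hH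
  -- ### curl and divergence vanish at the origin too (continuity)
  have hcurl_all : ∀ y, curl w y = 0 := by
    have hc : Continuous (curl w) := continuous_curl (hsmooth.of_le (by norm_cast))
    have hcl : IsClosed {y : EuclideanSpace ℝ (Fin 3) | curl w y = 0} := isClosed_eq hc continuous_const
    have hsub : closure U ⊆ {y | curl w y = 0} := hcl.closure_subset_iff.mpr fun y hy => hcurl_off y hy
    rw [hU, (dense_compl_singleton (0 : EuclideanSpace ℝ (Fin 3))).closure_eq] at hsub
    exact fun y => hsub (mem_univ y)
  have hdiv_all : VectorCalculus.IsDivFree w := by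
    have hc : Continuous fun y => VectorCalculus.divergence w y := by
      have e : (fun y => VectorCalculus.divergence w y) = fun y =>
          ∑ i, ⟪(EuclideanSpace.basisFun (Fin 3) ℝ) i, fderiv ℝ w y ((EuclideanSpace.basisFun (Fin 3) ℝ) i)⟫ :=
        funext fun y => divergence_eq_sum_inner_fderiv _ w y
      rw [e]
      refine continuous_finsetSum _ fun i _ => continuous_const.inner ?_
      exact (hsmooth.continuous_fderiv (by simp)).clm_apply continuous_const
    have hcl : IsClosed {y : EuclideanSpace ℝ (Fin 3) | VectorCalculus.divergence w y = 0} := isClosed_eq hc continuous_const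
    have hsub : closure U ⊆ {y | VectorCalculus.divergence w y = 0} :=
      hcl.closure_subset_iff.mpr fun y hy => hdiv_off y hy
    rw [hU, (dense_compl_singleton (0 : EuclideanSpace ℝ (Fin 3))).closure_eq] at hsub
    exact fun y => hsub (mem_univ y)
  -- ### growth
  refine ⟨hsmooth, hcurl_all, hdiv_all, M, C * CP + C * CG, fun y => ?_⟩
  have h1 : ‖w y‖ ≤ ‖τ y‖ + ‖V y‖ := by rw [hwf]; exact norm_sub_le _ _
  have h2 : ‖τ y‖ ≤ M := hM _
  have h3 := hVbd y
  have h4 : C * CP * ‖y‖ ≤ C * CP * (‖y‖ * (1 + |Real.log ‖y‖|)) := by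
    have : ‖y‖ ≤ ‖y‖ * (1 + |Real.log ‖y‖|) := by
      nlinarith [norm_nonneg y, abs_nonneg (Real.log ‖y‖)]
    exact mul_le_mul_of_nonneg_left this (by positivity)
  nlinarith

end Summit.NavierStokesRegularity.NavierStokesRegularity.Theorems.PoloidalLiouville.Antidynamo

end
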